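import Summits.QuantumFields.YangMills.Theorems.UnitScaleGibbsSmoothLatticeCutoffSpline
import HarnessLib

/-!
# `UnitScaleGibbsSmoothLatticeCutoff` — A SEPARABLE `C^{1,1}` LATTICE CUTOFF ON `ℤ^d`: `χ = 1` ON `box z R`, `χ = 0` OFF `box z (3R)`,
# `|∇χ| ≤ 2∕R` AND SECOND DIFFERENCES `|∇∇χ| ≤ 4∕R²` EVERYWHERE (the collar smoothness of the re-line of LINE 28 «GrossTransfer»;
# crux `UnitScaleTilt.HistoryTailL` stmt-QuantumFields-19936 ∕ `MeanDeviationL` stmt-QuantumFields-23083)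

Cell `ym3-torus` (YM ladder rung R3 = continuum SU(2) Yang–Mills on T³ — a RUNG, NOT the Clay problem: not d = 4, not infinite volume, not a mass gap),
width seat `ym-ust-19936-w2` (gen 15), pen of record of `stub_linTest`.  WHY (bus 2026-08-29, accounting v2 (A)∕(C)): the one non-Schwinger–Dyson row of
the re-lined `stub_linTest` pairs the cutoff COMMUTATORS of the truncated Coulomb potential `χ·δ₂(G₀∗w)` (✓`CovariantDischargeTruncatedPotentialPairing`:
`d(χa) = w − δ₃(χγ) − C₂ + E₁`, `E₁ ≍ ∇χ·a`, `C₂ ≍ ∇χ·γ`) with the dressed curvature, and ✓`UnitScaleGibbsCollarPairingSecondMoment` reduces that pairing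
to the `ℓ¹`-COBOUNDARY `Σ_b |δ₂(E₁ − C₂)|_b`, which involves SECOND differences of `χ`.  The lit∕(Z-b) cutoffs (✓`B4Eq19LatticeCaccioppoli.exists_cutoff`,
✓`CovariantDischargeCutoffCommutator.exists_cutoff_box_two_box`) export only the Lipschitz row.  THIS FILE builds a cutoff with BOTH rows, everywhere, with
absolute constants: the separable product `χ(x) = Π_i Φ(x_i − z_i + 3R)` of the one-dimensional `C^{1,1}` plateau `Φ(t) = σ(t) − σ(t − 4R)`, `σ` the
quadratic spline `0 ∕ t²∕(2R²) ∕ 1 − (2R−t)²∕(2R²) ∕ 1` on `t ≤ 0 ∕ 0 ≤ t ≤ R ∕ R ≤ t ≤ 2R ∕ 2R ≤ t` (the closed regimes OVERLAP CONSISTENTLY at the integer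
breakpoints, so consecutive integers always share a regime).  Every function is a FREE symbol pinned by a pointwise defining hypothesis (no `def`).
WHAT IS PROVED (FILE 2 of 2; the one-dimensional rows are FILE 1 ✓`UnitScaleGibbsSmoothLatticeCutoffSpline`; 0 `sorry`):
* §1 `spline_of_le_zero ∕ _of_mem_Icc_zero ∕ _of_mem_Icc ∕ _of_ge` (the four closed-regime evaluations), `spline_nonneg`, `spline_le_one`,
  ★`spline_fdiff_mem` (`0 ≤ σ(t+1) − σ t ≤ 1∕R`), `spline_monotone`, ★`abs_spline_sdiff_le` (`|σ(t+1) − 2σ t + σ(t−1)| ≤ 1∕R²`);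
* §2 the plateau `Φ = σ − σ(· − 4R)`: `plateau_mem_Icc` (`0 ≤ Φ ≤ 1`), `plateau_eq_one` (on `[2R,4R]`), `plateau_eq_zero_of_le ∕ _of_ge` (off `(0,6R)`),
  `abs_plateau_fdiff_le` (`≤ 2∕R`), `abs_plateau_sdiff_le` (`≤ 2∕R²`);
* §3 ★★★`exists_smooth_cutoff (z : Zd d) (hR : 1 ≤ R) : ∃ χ, (0 ≤ χ ≤ 1) ∧ (χ = 1 on box z R) ∧ (χ = 0 off box z (3R)) ∧ (|χ(x+e_μ) − χ x| ≤ 2∕R) ∧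
  (|χ(x−e_μ) − χ x| ≤ 2∕R) ∧ (|χ(x+e_κ+e_μ) − χ(x+e_κ) − χ(x+e_μ) + χ x| ≤ 4∕R²)` — any `d`.
HONEST FRAMING.  Elementary real arithmetic on `ℤ^d`; `--supports` helper; proves no stub, crux, rung or summit statement; `stub_linTest`,
«ShallowFluxSecondMomentL», (Q), K1, `MeanDeviationL`, `HistoryTailL` are NOT proved; the Yang–Mills mass gap is NOT proved.
References: Giaquinta, *Multiple integrals in the calculus of variations* (1983) Ch. III §2 (cutoff functions) [Giaquinta1984];
[Balaban1984PropagatorsII] (1.9) p. 226 (the lattice `ℤ^d` letters).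
-/

noncomputable section

set_option autoImplicit false

open scoped BigOperators
open Finset

namespace Summit.QuantumFields.YangMills.Theorems.UnitScaleGibbsSmoothLatticeCutoff

open Literature.MathematicalPhysics.QuantumFieldTheory.Balaban1983to89.B4Eq19LatticeOperators
open Summit.QuantumFields.YangMills.Theorems.UnitScaleGibbsSmoothLatticeCutoffSpline

/-! ## §3 The separable cutoff on `ℤ^d` -/

section Cutoff

variable {d : ℕ}

/-- Splitting a product over `Fin d` at one index. [folklore] -/
private theorem prod_eq_mul_prod_erase (g : Fin d → ℝ) (μ : Fin d) :
    ∏ i, g i = g μ * ∏ i ∈ (Finset.univ : Finset (Fin d)).erase μ, g i := by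
  rw [← Finset.mul_prod_erase (Finset.univ : Finset (Fin d)) g (Finset.mem_univ μ)]

/-- A product of numbers in `[0,1]` lies in `[0,1]`. [folklore] -/
private theorem prod_mem_Icc (s : Finset (Fin d)) (g : Fin d → ℝ) (hg : ∀ i, 0 ≤ g i ∧ g i ≤ 1) :
    0 ≤ ∏ i ∈ s, g i ∧ ∏ i ∈ s, g i ≤ 1 :=
  ⟨Finset.prod_nonneg fun i _ => (hg i).1, Finset.prod_le_one (fun i _ => (hg i).1) fun i _ => (hg i).2⟩

/-- ★★★ **THE `C^{1,1}` CUTOFF.**  For every centre `z : Zd d` and `R ≥ 1` there is `χ : Zd d → ℝ` with `0 ≤ χ ≤ 1`, `χ = 1` on `box z R`, `χ = 0` off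
`box z (3R)`, forward and backward Lipschitz rows `|χ(x ± e_μ) − χ x| ≤ 2∕R`, and the SECOND-DIFFERENCE row
`|χ(x + e_κ + e_μ) − χ(x + e_κ) − χ(x + e_μ) + χ x| ≤ 4∕R²` for all `x, κ, μ`. [folklore] -/
theorem exists_smooth_cutoff (z : Zd d) {R : ℕ} (hR1 : 1 ≤ R) :
    ∃ χ : Zd d → ℝ, (∀ x, 0 ≤ χ x ∧ χ x ≤ 1) ∧ (∀ x ∈ box z R, χ x = 1) ∧ (∀ x, x ∉ box z (3 * R) → χ x = 0) ∧
      (∀ x (μ : Fin d), |χ (x + unitVec μ) - χ x| ≤ 2 / (R : ℝ)) ∧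
      (∀ x (μ : Fin d), |χ (x - unitVec μ) - χ x| ≤ 2 / (R : ℝ)) ∧
      (∀ x (κ μ : Fin d), |χ (x + unitVec κ + unitVec μ) - χ (x + unitVec κ) - χ (x + unitVec μ) + χ x| ≤ 4 / (R : ℝ) ^ 2) := by
  classical
  have hR0 : (0 : ℝ) < R := by exact_mod_cast hR1
  -- the one-dimensional objects
  set σ : ℤ → ℝ := fun t => if t ≤ 0 then (0 : ℝ) else if t ≤ (R : ℤ) then ((t : ℝ) ^ 2) / (2 * (R : ℝ) ^ 2)
      else if t ≤ 2 * (R : ℤ) then 1 - ((2 * (R : ℝ) - t) ^ 2) / (2 * (R : ℝ) ^ 2) else 1 with hσdef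
  have hσ : ∀ t : ℤ, σ t = if t ≤ 0 then (0 : ℝ) else if t ≤ (R : ℤ) then ((t : ℝ) ^ 2) / (2 * (R : ℝ) ^ 2)
      else if t ≤ 2 * (R : ℤ) then 1 - ((2 * (R : ℝ) - t) ^ 2) / (2 * (R : ℝ) ^ 2) else 1 := fun t => rfl
  set Φ : ℤ → ℝ := fun t => σ t - σ (t - 4 * (R : ℤ)) with hΦdef
  have hΦ : ∀ t : ℤ, Φ t = σ t - σ (t - 4 * (R : ℤ)) := fun t => rfl
  -- the coordinate plateaus and the product
  set f : Zd d → Fin d → ℝ := fun x i => Φ (x i - z i + 3 * (R : ℤ)) with hfdef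
  refine ⟨fun x => ∏ i, f x i, fun x => prod_mem_Icc _ _ fun i => plateau_mem_Icc hσ hΦ hR1 _, ?_, ?_, ?_, ?_, ?_⟩
  · -- `χ = 1` on the inner box
    intro x hx
    rw [mem_box] at hx
    refine Finset.prod_eq_one fun i _ => ?_
    have h := hx i
    rw [abs_le] at h
    exact plateau_eq_one hσ hΦ hR1 (by omega) (by omega)
  · -- `χ = 0` off the outer box
    intro x hx
    rw [mem_box] at hx
    push Not at hx
    obtain ⟨i, hi⟩ := hx
    refine Finset.prod_eq_zero (Finset.mem_univ i) ?_
    have hi' : (3 * R : ℕ) < |x i - z i| := by exact_mod_cast hi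
    rcases le_or_gt 0 (x i - z i) with h | h
    · rw [abs_of_nonneg h] at hi'
      exact plateau_eq_zero_of_ge hσ hΦ hR1 (by push_cast at hi'; omega)
    · rw [abs_of_neg h] at hi'
      exact plateau_eq_zero_of_le hσ hΦ (by push_cast at hi'; omega)
  · -- forward Lipschitz
    intro x μ
    dsimp only
    have e1 : ∏ i, f (x + unitVec μ) i = f (x + unitVec μ) μ * ∏ i ∈ (Finset.univ : Finset (Fin d)).erase μ, f x i := by
      rw [prod_eq_mul_prod_erase _ μ]
      congr 1
      refine Finset.prod_congr rfl fun i hi => ?_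
      simp only [hfdef, Pi.add_apply, unitVec_apply_ne (Finset.ne_of_mem_erase hi), add_zero]
    have e2 : ∏ i, f x i = f x μ * ∏ i ∈ (Finset.univ : Finset (Fin d)).erase μ, f x i := prod_eq_mul_prod_erase _ μ
    rw [e1, e2, ← sub_mul, abs_mul]
    have hP := prod_mem_Icc ((Finset.univ : Finset (Fin d)).erase μ) (f x) fun i => plateau_mem_Icc hσ hΦ hR1 _
    have hΔ : |f (x + unitVec μ) μ - f x μ| ≤ 2 / (R : ℝ) := by
      simp only [hfdef, Pi.add_apply, unitVec_apply_self]
      rw [show x μ + 1 - z μ + 3 * (R : ℤ) = (x μ - z μ + 3 * (R : ℤ)) + 1 by ring]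
      exact abs_plateau_fdiff_le hσ hΦ hR1 _
    calc |f (x + unitVec μ) μ - f x μ| * |∏ i ∈ (Finset.univ : Finset (Fin d)).erase μ, f x i|
        ≤ 2 / (R : ℝ) * 1 := by
          rw [abs_of_nonneg hP.1]
          exact mul_le_mul hΔ hP.2 hP.1 (by positivity)
      _ = 2 / (R : ℝ) := mul_one _
  · -- backward Lipschitz (from the forward row at `x − e_μ`)
    intro x μ
    dsimp only
    have e1 : ∏ i, f (x - unitVec μ) i = f (x - unitVec μ) μ * ∏ i ∈ (Finset.univ : Finset (Fin d)).erase μ, f x i := by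
      rw [prod_eq_mul_prod_erase _ μ]
      congr 1
      refine Finset.prod_congr rfl fun i hi => ?_
      simp only [hfdef, Pi.sub_apply, unitVec_apply_ne (Finset.ne_of_mem_erase hi), sub_zero]
    have e2 : ∏ i, f x i = f x μ * ∏ i ∈ (Finset.univ : Finset (Fin d)).erase μ, f x i := prod_eq_mul_prod_erase _ μ
    rw [e1, e2, ← sub_mul, abs_mul]
    have hP := prod_mem_Icc ((Finset.univ : Finset (Fin d)).erase μ) (f x) fun i => plateau_mem_Icc hσ hΦ hR1 _
    have hΔ : |f (x - unitVec μ) μ - f x μ| ≤ 2 / (R : ℝ) := by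
      simp only [hfdef, Pi.sub_apply, unitVec_apply_self]
      rw [abs_sub_comm, show x μ - z μ + 3 * (R : ℤ) = (x μ - 1 - z μ + 3 * (R : ℤ)) + 1 by ring]
      exact abs_plateau_fdiff_le hσ hΦ hR1 _
    calc |f (x - unitVec μ) μ - f x μ| * |∏ i ∈ (Finset.univ : Finset (Fin d)).erase μ, f x i|
        ≤ 2 / (R : ℝ) * 1 := by
          rw [abs_of_nonneg hP.1]
          exact mul_le_mul hΔ hP.2 hP.1 (by positivity)
      _ = 2 / (R : ℝ) := mul_one _
  · -- second differences
    intro x κ μ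
    dsimp only
    by_cases hκμ : κ = μ
    · -- same direction: `Δ²Φ` in coordinate `μ`, the other factors unchanged
      subst hκμ
      set P : ℝ := ∏ i ∈ (Finset.univ : Finset (Fin d)).erase κ, f x i with hPdef
      have hrest : ∀ (y : Zd d), (∀ i, i ≠ κ → y i = x i) → ∏ i ∈ (Finset.univ : Finset (Fin d)).erase κ, f y i = P := by
        intro y hy
        rw [hPdef]
        refine Finset.prod_congr rfl fun i hi => ?_
        simp only [hfdef, hy i (Finset.ne_of_mem_erase hi)]
      have e0 : ∏ i, f x i = f x κ * P := prod_eq_mul_prod_erase _ κ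
      have e1 : ∏ i, f (x + unitVec κ) i = f (x + unitVec κ) κ * P := by
        rw [prod_eq_mul_prod_erase _ κ, hrest _ (fun i hi => by simp [unitVec_apply_ne hi])]
      have e2 : ∏ i, f (x + unitVec κ + unitVec κ) i = f (x + unitVec κ + unitVec κ) κ * P := by
        rw [prod_eq_mul_prod_erase _ κ, hrest _ (fun i hi => by simp [unitVec_apply_ne hi])]
      rw [e0, e1, e2]
      have hP := prod_mem_Icc ((Finset.univ : Finset (Fin d)).erase κ) (f x) fun i => plateau_mem_Icc hσ hΦ hR1 _
      rw [← hPdef] at hP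
      have hΔ : |f (x + unitVec κ + unitVec κ) κ - f (x + unitVec κ) κ - f (x + unitVec κ) κ + f x κ| ≤ 2 / (R : ℝ) ^ 2 := by
        simp only [hfdef, Pi.add_apply, unitVec_apply_self]
        have h := abs_plateau_sdiff_le hσ hΦ hR1 (x κ - z κ + 3 * (R : ℤ) + 1)
        rw [show x κ + 1 + 1 - z κ + 3 * (R : ℤ) = x κ - z κ + 3 * (R : ℤ) + 1 + 1 by ring,
          show x κ + 1 - z κ + 3 * (R : ℤ) = x κ - z κ + 3 * (R : ℤ) + 1 by ring,
          show x κ - z κ + 3 * (R : ℤ) = x κ - z κ + 3 * (R : ℤ) + 1 - 1 by ring]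
        rw [show x κ - z κ + 3 * (R : ℤ) + 1 - 1 + 1 + 1 = x κ - z κ + 3 * (R : ℤ) + 1 + 1 by ring,
          show x κ - z κ + 3 * (R : ℤ) + 1 - 1 + 1 = x κ - z κ + 3 * (R : ℤ) + 1 by ring]
        calc _ = |Φ (x κ - z κ + 3 * (R : ℤ) + 1 + 1) - 2 * Φ (x κ - z κ + 3 * (R : ℤ) + 1) + Φ (x κ - z κ + 3 * (R : ℤ) + 1 - 1)| := by
              ring_nf
          _ ≤ _ := h
      calc |f (x + unitVec κ + unitVec κ) κ * P - f (x + unitVec κ) κ * P - f (x + unitVec κ) κ * P + f x κ * P|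
          = |f (x + unitVec κ + unitVec κ) κ - f (x + unitVec κ) κ - f (x + unitVec κ) κ + f x κ| * P := by
            rw [show f (x + unitVec κ + unitVec κ) κ * P - f (x + unitVec κ) κ * P - f (x + unitVec κ) κ * P + f x κ * P =
              (f (x + unitVec κ + unitVec κ) κ - f (x + unitVec κ) κ - f (x + unitVec κ) κ + f x κ) * P by ring, abs_mul, abs_of_nonneg hP.1]
        _ ≤ 2 / (R : ℝ) ^ 2 * 1 := mul_le_mul hΔ hP.2 hP.1 (by positivity)
        _ ≤ 4 / (R : ℝ) ^ 2 := by rw [mul_one]; exact div_le_div_of_nonneg_right (by norm_num) (by positivity)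
    · -- distinct directions: product of two first differences
      set P : ℝ := ∏ i ∈ ((Finset.univ : Finset (Fin d)).erase κ).erase μ, f x i with hPdef
      have hμκ : μ ∈ (Finset.univ : Finset (Fin d)).erase κ := Finset.mem_erase.mpr ⟨fun h => hκμ h.symm, Finset.mem_univ μ⟩
      have hsplit : ∀ (y : Zd d), (∀ i, i ≠ κ → i ≠ μ → y i = x i) → ∏ i, f y i = f y κ * (f y μ * P) := by
        intro y hy
        rw [prod_eq_mul_prod_erase _ κ, ← Finset.mul_prod_erase _ _ hμκ, hPdef]
        congr 2
        refine Finset.prod_congr rfl fun i hi => ?_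
        have hi1 : i ≠ μ := Finset.ne_of_mem_erase hi
        have hi2 : i ≠ κ := Finset.ne_of_mem_erase (Finset.mem_of_mem_erase hi)
        simp only [hfdef, hy i hi2 hi1]
      have e0 : ∏ i, f x i = f x κ * (f x μ * P) := hsplit x (fun _ _ _ => rfl)
      have e1 : ∏ i, f (x + unitVec κ) i = f (x + unitVec κ) κ * (f x μ * P) := by
        rw [hsplit _ (fun i hi _ => by simp [unitVec_apply_ne hi])]
        simp [hfdef, unitVec_apply_ne (Ne.symm hκμ)]
      have e2 : ∏ i, f (x + unitVec μ) i = f x κ * (f (x + unitVec μ) μ * P) := by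
        rw [hsplit _ (fun i _ hi => by simp [unitVec_apply_ne hi])]
        simp [hfdef, unitVec_apply_ne hκμ]
      have e3 : ∏ i, f (x + unitVec κ + unitVec μ) i = f (x + unitVec κ) κ * (f (x + unitVec μ) μ * P) := by
        rw [hsplit _ (fun i hi1 hi2 => by simp [unitVec_apply_ne hi1, unitVec_apply_ne hi2])]
        simp [hfdef, unitVec_apply_ne hκμ, unitVec_apply_ne (Ne.symm hκμ)]
      rw [e0, e1, e2, e3]
      have hP : 0 ≤ P ∧ P ≤ 1 := prod_mem_Icc _ _ fun i => plateau_mem_Icc hσ hΦ hR1 _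
      have hΔκ : |f (x + unitVec κ) κ - f x κ| ≤ 2 / (R : ℝ) := by
        simp only [hfdef, Pi.add_apply, unitVec_apply_self]
        rw [show x κ + 1 - z κ + 3 * (R : ℤ) = (x κ - z κ + 3 * (R : ℤ)) + 1 by ring]
        exact abs_plateau_fdiff_le hσ hΦ hR1 _
      have hΔμ : |f (x + unitVec μ) μ - f x μ| ≤ 2 / (R : ℝ) := by
        simp only [hfdef, Pi.add_apply, unitVec_apply_self]
        rw [show x μ + 1 - z μ + 3 * (R : ℤ) = (x μ - z μ + 3 * (R : ℤ)) + 1 by ring]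
        exact abs_plateau_fdiff_le hσ hΦ hR1 _
      rw [show f (x + unitVec κ) κ * (f (x + unitVec μ) μ * P) - f (x + unitVec κ) κ * (f x μ * P) - f x κ * (f (x + unitVec μ) μ * P) +
          f x κ * (f x μ * P) = (f (x + unitVec κ) κ - f x κ) * (f (x + unitVec μ) μ - f x μ) * P by ring, abs_mul, abs_mul, abs_of_nonneg hP.1]
      calc |f (x + unitVec κ) κ - f x κ| * |f (x + unitVec μ) μ - f x μ| * P ≤ 2 / (R : ℝ) * (2 / (R : ℝ)) * 1 :=
            mul_le_mul (mul_le_mul hΔκ hΔμ (abs_nonneg _) (by positivity)) hP.2 hP.1 (by positivity)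
        _ = 4 / (R : ℝ) ^ 2 := by ring

end Cutoff

end Summit.QuantumFields.YangMills.Theorems.UnitScaleGibbsSmoothLatticeCutoff

end
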